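import Summits.RiemannHypothesis.RiemannHypothesis.Theorems.WeilGroundStateGroundStatesConvergeToXiStubZeroSideTruncation
import Summits.RiemannHypothesis.RiemannHypothesis.Theorems.WeilGroundStateGroundStatesConvergeToXiMellinByParts
import Summits.RiemannHypothesis.RiemannHypothesis.Theorems.WeilGroundStateGroundStatesConvergeToXiCutoff
import Literature.NumberTheory.LFunctions.WeilExplicit
import Literature.NumberTheory.LFunctions.WeilExplicitRightEdge
import Literature.Analysis.SpecialFunctions.DigammaLogBound
import Literature.Analysis.SpecialFunctions.DigammaVerticalAsymptotics
import Literature.Analysis.Calculus.SmoothCutoff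
import Mathlib.Analysis.SpecialFunctions.JapaneseBracket
import HarnessLib

/-!
# `WeilGroundState.GroundStatesConvergeToXi` — archimedean (digamma form) and polar sides of the explicit formula under plateau truncation
(crux item stmt-RiemannHypothesis-1527, route route-RiemannHypothesis-WeilGroundState; line `Sketch`,
stub `stub_archPolar_truncation` (W12c); `--supports`)

Test functions of the EXPONENTIAL WEIL CLASS: `f : ℝ → ℂ` smooth with
`‖f‖, ‖f'‖, ‖f''‖ ≤ C e^{-b₀|t|}`, `b₀ > 1/2`.  Plateau truncation `f_R = f · χ_R`
(`χ_R = Literature.Analysis.Calculus.cutoff R`: `= 1` on `|t| ≤ R − 1`, `= 0` on `|t| ≥ R`).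

* The archimedean integrand `t ↦ f̂(1/2 + it) Re ψ(1/4 + it/2)` is integrable: `f̂(1/2 + it)` is
  continuous in `t` (dominated parametric integral) with `‖f̂(1/2 + it)‖ ≤ K/(1 + t²)`
  (`zsTrunc_norm_weilMellin_le`, two integrations by parts), and
  `|Re ψ(1/4 + it/2)| ≤ C_ψ + log(1 + |t|)`
  (`Literature.Analysis.SpecialFunctions.Complex.exists_norm_digamma_vertical_le`), while
  `(C_ψ + log(1 + |t|))/(1 + t²) ≤ 2(C_ψ + 2)(1 + |t|)^{-3/2}` is integrable.
* `weilArchTerm f_R → weilArchTerm f`: dominated convergence in `weilArchIntegral` with the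
  `R`-uniform majorant `(K + 1)(C_ψ + log(1 + |t|))/(1 + t²)` and the pointwise convergence
  `‖f̂(1/2 + it) − f̂_R(1/2 + it)‖ ≤ τ(R)/(1 + t²) → 0` (`zsTrunc_tail_control`); and
  `f_R(0) = f(0)` for `R ≥ 1`.
* `weilPolarTerm f_R → weilPolarTerm f`: `‖f̂(σ) − f̂_R(σ)‖ ≤ τ(R)` at `σ = 0, 1`.

No new definitions; no named fact is used.
-/

noncomputable section

set_option linter.dupNamespace false

open scoped Topology Real
open Filter Set MeasureTheory Complex

namespace Summit.RiemannHypothesis.RiemannHypothesis.Theorems.GroundStatesConvergeToXi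

open Literature.NumberTheory.LFunctions

/-! ## The critical line -/

/-- `Re(1/2 + it) = 1/2`. [folklore] -/
theorem apTrunc_half_re (t : ℝ) : (1 / 2 + (t : ℂ) * I).re = 1 / 2 := by
  simp

/-- `Im(1/2 + it) = t`. [folklore] -/
theorem apTrunc_half_im (t : ℝ) : (1 / 2 + (t : ℂ) * I).im = t := by
  simp

/-- In the closed strip `0 ≤ Re s ≤ 1`: `‖g(t) e^{(s-1/2)t}‖ ≤ ‖g(t)‖ e^{|t|/2}`. [folklore] -/
theorem apTrunc_norm_mul_cexp_le {s : ℂ} (hs0 : 0 ≤ s.re) (hs1 : s.re ≤ 1) (g : ℝ → ℂ) (t : ℝ) :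
    ‖g t * cexp ((s - 1 / 2) * t)‖ ≤ ‖g t‖ * Real.exp (|t| / 2) := by
  rw [norm_mul, Complex.norm_exp]
  refine mul_le_mul_of_nonneg_left (Real.exp_le_exp.2 ?_) (norm_nonneg _)
  have hre : ((s - 1 / 2) * (t : ℂ)).re = (s.re - 1 / 2) * t := by
    simp [sub_re, mul_re]
  rw [hre]
  have h1 : |s.re - 1 / 2| ≤ 1 / 2 := abs_le.2 ⟨by linarith, by linarith⟩
  calc (s.re - 1 / 2) * t ≤ |(s.re - 1 / 2) * t| := le_abs_self _
    _ = |s.re - 1 / 2| * |t| := abs_mul _ _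
    _ ≤ 1 / 2 * |t| := mul_le_mul_of_nonneg_right h1 (abs_nonneg _)
    _ = |t| / 2 := by ring

/-- **Continuity of `t ↦ ĝ(1/2 + it)` in the exponential class**: for continuous `g` with
`‖g(t)‖ ≤ K e^{-b₀|t|}`, `b₀ > 1/2` (continuity of a dominated parametric integral, majorant
`K e^{-b₀|u|} e^{|u|/2}`). [folklore] -/
theorem apTrunc_continuous_weilMellin_half {g : ℝ → ℂ} (hg : Continuous g) {K b₀ : ℝ}
    (hb : 1 / 2 < b₀) (hK : ∀ t, ‖g t‖ ≤ K * Real.exp (-(b₀ * |t|))) :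
    Continuous fun t : ℝ => weilMellin g (1 / 2 + t * I) := by
  unfold weilMellin
  refine continuous_of_dominated
    (F := fun (t : ℝ) (u : ℝ) => g u * cexp ((1 / 2 + t * I - 1 / 2) * u))
    (bound := fun u : ℝ => K * (Real.exp (-(b₀ * |u|)) * Real.exp (|u| / 2)))
    (fun t => ?_) (fun t => ae_of_all _ fun u => ?_)
    ((zsTrunc_integrable_exp_weight hb).const_mul K) (ae_of_all _ fun u => ?_)
  · exact (hg.mul (by fun_prop)).aestronglyMeasurable
  · calc ‖g u * cexp ((1 / 2 + t * I - 1 / 2) * u)‖ ≤ ‖g u‖ * Real.exp (|u| / 2) :=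
          apTrunc_norm_mul_cexp_le (by rw [apTrunc_half_re]; norm_num)
            (by rw [apTrunc_half_re]; norm_num) g u
      _ ≤ K * Real.exp (-(b₀ * |u|)) * Real.exp (|u| / 2) :=
          mul_le_mul_of_nonneg_right (hK u) (Real.exp_pos _).le
      _ = K * (Real.exp (-(b₀ * |u|)) * Real.exp (|u| / 2)) := by ring
  · fun_prop

/-! ## The digamma weight `t ↦ Re ψ(1/4 + it/2)` -/

/-- **Logarithmic size of the weight**: there is `C ≥ 0` with
`|Re ψ(1/4 + it/2)| ≤ C + log(1 + |t|)` for all real `t`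
(`Literature.Analysis.SpecialFunctions.Complex.exists_norm_digamma_vertical_le` on `Re w = 1/4`,
`log(1 + |t|/2) ≤ log(1 + |t|)`). [folklore] -/
theorem apTrunc_digammaWeight_bound :
    ∃ C : ℝ, 0 ≤ C ∧ ∀ t : ℝ,
      ‖(((Complex.digamma (1 / 4 + t / 2 * I)).re : ℝ) : ℂ)‖ ≤ C + Real.log (1 + |t|) := by
  obtain ⟨C, hC⟩ :=
    Literature.Analysis.SpecialFunctions.Complex.exists_norm_digamma_vertical_le
      (a := 1 / 4) (by norm_num)
  have hC0 : 0 ≤ C := by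
    have h := hC 0
    simp only [abs_zero, add_zero, Real.log_one] at h
    exact (norm_nonneg _).trans h
  refine ⟨C, hC0, fun t => ?_⟩
  have h := hC (t / 2)
  have hw : ((1 / 4 : ℝ) : ℂ) + ((t / 2 : ℝ) : ℂ) * I = 1 / 4 + (t : ℂ) / 2 * I := by
    push_cast
    ring
  rw [hw] at h
  have h2 : Real.log (1 + |t / 2|) ≤ Real.log (1 + |t|) := by
    refine Real.log_le_log (by positivity) ?_
    rw [abs_div, abs_two]
    linarith [abs_nonneg t]
  calc ‖(((Complex.digamma (1 / 4 + t / 2 * I)).re : ℝ) : ℂ)‖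
      = |(Complex.digamma (1 / 4 + t / 2 * I)).re| := by
        rw [Complex.norm_real, Real.norm_eq_abs]
    _ ≤ ‖Complex.digamma (1 / 4 + t / 2 * I)‖ := Complex.abs_re_le_norm _
    _ ≤ C + Real.log (1 + |t|) := by linarith

/-- Continuity of the weight `t ↦ Re ψ(1/4 + it/2)` (`ψ` is continuous on `Re w > 0`). [folklore] -/
theorem apTrunc_continuous_digammaWeight :
    Continuous fun t : ℝ => (((Complex.digamma (1 / 4 + t / 2 * I)).re : ℝ) : ℂ) := by
  have h : Continuous fun t : ℝ => Complex.digamma (1 / 4 + t / 2 * I) := by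
    refine Literature.Analysis.SpecialFunctions.Complex.continuousOn_digamma.comp_continuous
      (by fun_prop) fun t => ?_
    simp only [mem_setOf_eq, add_re, mul_re, I_re, I_im, div_ofNat_re, div_ofNat_im, ofReal_re,
      ofReal_im]
    norm_num
  exact Complex.continuous_ofReal.comp (Complex.continuous_re.comp h)

/-- **The logarithmic majorant is integrable**: `(A + log(1 + |t|))/(1 + t²)` (`A ≥ 0`) is
integrable on `ℝ`, being at most `2(A + 2)(1 + |t|)^{-3/2}` (`log u ≤ 2u^{1/2}`,
`(1 + |t|)² ≤ 2(1 + t²)`; `integrable_one_add_norm`). [folklore] -/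
theorem apTrunc_integrable_log_div {A : ℝ} (hA : 0 ≤ A) :
    Integrable fun t : ℝ => (A + Real.log (1 + |t|)) / (1 + t ^ 2) := by
  have hI : Integrable fun t : ℝ => (1 + ‖t‖) ^ (-(3 / 2 : ℝ)) :=
    integrable_one_add_norm (by rw [Module.finrank_self]; norm_num)
  refine (hI.const_mul (2 * (A + 2))).mono' ?_ (ae_of_all _ fun t => ?_)
  · refine Continuous.aestronglyMeasurable ?_
    exact Continuous.div (continuous_const.add ((continuous_const.add continuous_abs).log fun t =>
      (by positivity : (0 : ℝ) < 1 + |t|).ne')) (by fun_prop)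
      fun t => (by positivity : (1 + t ^ 2 : ℝ) ≠ 0)
  · rw [Real.norm_eq_abs, Real.norm_eq_abs]
    have hu1 : 1 ≤ 1 + |t| := by linarith [abs_nonneg t]
    have hu0 : 0 < 1 + |t| := by linarith
    have hlog0 : 0 ≤ Real.log (1 + |t|) := Real.log_nonneg hu1
    have hlog : Real.log (1 + |t|) ≤ 2 * (1 + |t|) ^ (1 / 2 : ℝ) := by
      have h := Real.log_le_rpow_div hu0.le (by norm_num : (0 : ℝ) < 1 / 2)
      have e : (1 + |t|) ^ (1 / 2 : ℝ) / (1 / 2) = 2 * (1 + |t|) ^ (1 / 2 : ℝ) := by ring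
      linarith
    have hsqrt1 : 1 ≤ (1 + |t|) ^ (1 / 2 : ℝ) := Real.one_le_rpow hu1 (by norm_num)
    have hnum : A + Real.log (1 + |t|) ≤ (A + 2) * (1 + |t|) ^ (1 / 2 : ℝ) := by nlinarith
    have hden : (1 + |t|) ^ 2 / 2 ≤ 1 + t ^ 2 := by
      nlinarith [abs_nonneg t, sq_abs t, sq_nonneg (|t| - 1)]
    have hpow : (1 + |t|) ^ (-(3 / 2 : ℝ)) = (1 + |t|) ^ (1 / 2 : ℝ) / (1 + |t|) ^ 2 := by
      rw [show (-(3 / 2 : ℝ)) = 1 / 2 - 2 by norm_num, Real.rpow_sub hu0, Real.rpow_two]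
    rw [abs_of_nonneg (by positivity), hpow]
    have hsq : 0 < (1 + |t|) ^ 2 / 2 := by positivity
    calc (A + Real.log (1 + |t|)) / (1 + t ^ 2)
        ≤ (A + 2) * (1 + |t|) ^ (1 / 2 : ℝ) / (1 + t ^ 2) := by gcongr
      _ ≤ (A + 2) * (1 + |t|) ^ (1 / 2 : ℝ) / ((1 + |t|) ^ 2 / 2) :=
          div_le_div_of_nonneg_left (by positivity) hsq hden
      _ = 2 * (A + 2) * ((1 + |t|) ^ (1 / 2 : ℝ) / (1 + |t|) ^ 2) := by
          field_simp

/-- **Integrability against the weight from quadratic decay**: if `F` is a.e.-strongly measurable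
with `‖F(t)‖ ≤ K/(1 + t²)`, then `t ↦ F(t) Re ψ(1/4 + it/2)` is integrable on `ℝ`. [folklore] -/
theorem apTrunc_integrable_mul_digammaWeight {F : ℝ → ℂ} (hF : AEStronglyMeasurable F) {K : ℝ}
    (hK : ∀ t, ‖F t‖ ≤ K / (1 + t ^ 2)) :
    Integrable fun t : ℝ => F t * (((Complex.digamma (1 / 4 + t / 2 * I)).re : ℝ) : ℂ) := by
  obtain ⟨C, hC0, hC⟩ := apTrunc_digammaWeight_bound
  refine ((apTrunc_integrable_log_div hC0).const_mul K).mono'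
    (hF.mul apTrunc_continuous_digammaWeight.aestronglyMeasurable) (ae_of_all _ fun t => ?_)
  rw [norm_mul]
  have hpos : 0 < 1 + t ^ 2 := by positivity
  have hK0 : 0 ≤ K / (1 + t ^ 2) := (norm_nonneg _).trans (hK t)
  calc ‖F t‖ * ‖(((Complex.digamma (1 / 4 + t / 2 * I)).re : ℝ) : ℂ)‖
      ≤ K / (1 + t ^ 2) * (C + Real.log (1 + |t|)) :=
        mul_le_mul (hK t) (hC t) (norm_nonneg _) hK0
    _ = K * ((C + Real.log (1 + |t|)) / (1 + t ^ 2)) := by ring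

/-! ## Truncation -/

section Trunc

open Literature.Analysis.Calculus

/-- `f χ_R` is continuous for continuous `f`. [folklore] -/
theorem apTrunc_continuous_trunc {f : ℝ → ℂ} (hfc : Continuous f) (R : ℝ) :
    Continuous fun t : ℝ => f t * ((cutoff R t : ℝ) : ℂ) := by
  have hcχ : Continuous fun t : ℝ => ((cutoff R t : ℝ) : ℂ) :=
    Complex.continuous_ofReal.comp (contDiff_cutoff R (n := 0)).continuous
  exact hfc.mul hcχ

/-- `‖f χ_R‖ ≤ C e^{-b₀|t|}` whenever `‖f‖ ≤ C e^{-b₀|t|}` (`0 ≤ χ_R ≤ 1`). [folklore] -/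
theorem apTrunc_norm_trunc_le {f : ℝ → ℂ} {C b₀ : ℝ} (h0 : ∀ t, ‖f t‖ ≤ C * Real.exp (-(b₀ * |t|)))
    (R t : ℝ) : ‖f t * ((cutoff R t : ℝ) : ℂ)‖ ≤ C * Real.exp (-(b₀ * |t|)) := by
  rw [norm_mul, Complex.norm_real, Real.norm_eq_abs, abs_of_nonneg (cutoff_nonneg R t)]
  exact (mul_le_of_le_one_right (norm_nonneg _) (cutoff_le_one R t)).trans (h0 t)

/-- **Archimedean integrals under truncation.** If `‖f̂(1/2 + it)‖ ≤ K/(1 + t²)`, the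
functions `t ↦ f̂_R(1/2 + it)` are continuous, and
`‖f̂(s) − f̂_R(s)‖ ≤ τ(R)/(1 + (Im s)²)` in the closed strip with `τ(R) → 0`, then
`weilArchIntegral f_R → weilArchIntegral f` (dominated convergence, majorant
`(K + 1)(C_ψ + log(1 + |t|))/(1 + t²)`). [folklore] -/
theorem apTrunc_tendsto_weilArchIntegral {f : ℝ → ℂ} {g : ℝ → ℝ → ℂ} {K : ℝ}
    (hKb : ∀ t : ℝ, ‖weilMellin f (1 / 2 + t * I)‖ ≤ K / (1 + t ^ 2))
    (hGc : ∀ R, Continuous fun t : ℝ => weilMellin (g R) (1 / 2 + t * I))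
    {τ : ℝ → ℝ} (hτ : Tendsto τ atTop (𝓝 0))
    (hτb : ∀ (R : ℝ) (s : ℂ), 0 ≤ s.re → s.re ≤ 1 →
      ‖weilMellin f s - weilMellin (g R) s‖ ≤ τ R / (1 + s.im ^ 2)) :
    Tendsto (fun R : ℝ => weilArchIntegral (g R)) atTop (𝓝 (weilArchIntegral f)) := by
  obtain ⟨Cψ, hCψ0, hCψ⟩ := apTrunc_digammaWeight_bound
  have hK0 : 0 ≤ K := by
    have h := hKb 0
    norm_num at h
    exact (norm_nonneg _).trans h
  have hτ1 : ∀ᶠ R in atTop, τ R ≤ 1 := hτ.eventually (eventually_le_nhds zero_lt_one)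
  have hdiff : ∀ (R t : ℝ), ‖weilMellin f (1 / 2 + t * I) - weilMellin (g R) (1 / 2 + t * I)‖ ≤
      τ R / (1 + t ^ 2) := by
    intro R t
    have h := hτb R (1 / 2 + t * I) (by rw [apTrunc_half_re]; norm_num)
      (by rw [apTrunc_half_re]; norm_num)
    rwa [apTrunc_half_im] at h
  unfold weilArchIntegral
  refine tendsto_integral_filter_of_dominated_convergence
    (fun t : ℝ => (K + 1) * ((Cψ + Real.log (1 + |t|)) / (1 + t ^ 2)))
    (Eventually.of_forall fun R => ?_) ?_ ((apTrunc_integrable_log_div hCψ0).const_mul (K + 1))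
    (ae_of_all _ fun t => ?_)
  · exact ((hGc R).mul apTrunc_continuous_digammaWeight).aestronglyMeasurable
  · filter_upwards [hτ1] with R hR
    refine ae_of_all _ fun t => ?_
    have hpos : 0 < 1 + t ^ 2 := by positivity
    have hn : ‖weilMellin (g R) (1 / 2 + t * I)‖ ≤ (K + 1) / (1 + t ^ 2) := by
      calc ‖weilMellin (g R) (1 / 2 + t * I)‖
          ≤ ‖weilMellin f (1 / 2 + t * I)‖ +
              ‖weilMellin f (1 / 2 + t * I) - weilMellin (g R) (1 / 2 + t * I)‖ :=
            norm_le_insert _ _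
        _ ≤ K / (1 + t ^ 2) + τ R / (1 + t ^ 2) := add_le_add (hKb t) (hdiff R t)
        _ = (K + τ R) / (1 + t ^ 2) := by rw [add_div]
        _ ≤ (K + 1) / (1 + t ^ 2) := by gcongr
    rw [norm_mul]
    calc ‖weilMellin (g R) (1 / 2 + t * I)‖ *
          ‖(((Complex.digamma (1 / 4 + t / 2 * I)).re : ℝ) : ℂ)‖
        ≤ (K + 1) / (1 + t ^ 2) * (Cψ + Real.log (1 + |t|)) :=
          mul_le_mul hn (hCψ t) (norm_nonneg _) (by positivity)
      _ = (K + 1) * ((Cψ + Real.log (1 + |t|)) / (1 + t ^ 2)) := by ring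
  · have hlim : Tendsto (fun R : ℝ => weilMellin (g R) (1 / 2 + t * I)) atTop
        (𝓝 (weilMellin f (1 / 2 + t * I))) := by
      rw [tendsto_iff_norm_sub_tendsto_zero]
      refine squeeze_zero (fun R => norm_nonneg _) (fun R => ?_)
        (show Tendsto (fun R => τ R / (1 + t ^ 2)) atTop (𝓝 0) by
          simpa using hτ.div_const (1 + t ^ 2))
      rw [norm_sub_rev]
      exact hdiff R t
    exact hlim.mul_const _

end Trunc

/-! ## The stub -/

/-- **Stub W12c — `archPolar_truncation` (RH-free).**  For `f` in the exponential Weil class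
(`f` smooth, `‖f‖, ‖f'‖, ‖f''‖ ≤ C e^{-b₀|t|}`, `b₀ > 1/2`): the archimedean integrand
`f̂(1/2 + it) Re ψ(1/4 + it/2)` of the digamma form of the explicit formula is integrable, and
along the plateau truncations `f_R = f · χ_R` (`R → ∞`) the archimedean terms
`weilArchTerm f_R → weilArchTerm f` and the polar terms `weilPolarTerm f_R → weilPolarTerm f`
converge (`‖f̂ − f̂_R‖ ≤ τ(R)/(1 + (Im s)²)` in the closed strip with `τ(R) → 0`, dominated
convergence against the logarithmic weight, `f_R(0) = f(0)` for `R ≥ 1`). [folklore] -/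
theorem stub_archPolar_truncation :
    ∀ (f : ℝ → ℂ) (C b₀ : ℝ), ContDiff ℝ (⊤ : ℕ∞) f → 1 / 2 < b₀ →
      (∀ t, ‖f t‖ ≤ C * Real.exp (-(b₀ * |t|))) →
      (∀ t, ‖deriv f t‖ ≤ C * Real.exp (-(b₀ * |t|))) →
      (∀ t, ‖deriv (deriv f) t‖ ≤ C * Real.exp (-(b₀ * |t|))) →
      Integrable (fun t : ℝ =>
          weilMellin f (1 / 2 + t * I) * ((Complex.digamma (1 / 4 + t / 2 * I)).re : ℂ)) ∧
      Tendsto (fun R : ℝ =>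
          weilArchTerm (fun t : ℝ => f t * ((Literature.Analysis.Calculus.cutoff R t : ℝ) : ℂ)))
        atTop (𝓝 (weilArchTerm f)) ∧
      Tendsto (fun R : ℝ =>
          weilPolarTerm (fun t : ℝ => f t * ((Literature.Analysis.Calculus.cutoff R t : ℝ) : ℂ)))
        atTop (𝓝 (weilPolarTerm f)) := by
  intro f C b₀ hf hb h0 h1 h2
  -- two derivatives of `f`
  have hdf : Differentiable ℝ f := (contDiff_infty_iff_deriv.mp hf).1
  have hf' : ContDiff ℝ (⊤ : ℕ∞) (deriv f) := (contDiff_infty_iff_deriv.mp hf).2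
  have hdf' : Differentiable ℝ (deriv f) := (contDiff_infty_iff_deriv.mp hf').1
  have hc'' : Continuous (deriv (deriv f)) := (contDiff_infty_iff_deriv.mp hf').2.continuous
  have hd : ∀ t, HasDerivAt f (deriv f t) t := fun t => (hdf t).hasDerivAt
  have hd' : ∀ t, HasDerivAt (deriv f) (deriv (deriv f) t) t := fun t => (hdf' t).hasDerivAt
  have hfc : Continuous f := hdf.continuous
  -- decay of `f̂` on the critical line
  set K : ℝ := 2 * ((∫ t : ℝ, ‖f t‖ * Real.exp (|t| / 2)) +
    ∫ t : ℝ, ‖deriv (deriv f) t‖ * Real.exp (|t| / 2)) with hK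
  have hKb : ∀ t : ℝ, ‖weilMellin f (1 / 2 + t * I)‖ ≤ K / (1 + t ^ 2) := by
    intro t
    have h := zsTrunc_norm_weilMellin_le hd hd' hc'' hb h0 h1 h2 (s := 1 / 2 + t * I)
      (by rw [apTrunc_half_re]; norm_num) (by rw [apTrunc_half_re]; norm_num)
    rwa [apTrunc_half_im] at h
  -- continuity on the critical line, tail control
  have hFc : Continuous fun t : ℝ => weilMellin f (1 / 2 + t * I) :=
    apTrunc_continuous_weilMellin_half hfc hb h0
  obtain ⟨τ, hτ, hτb⟩ := zsTrunc_tail_control hb hd hd' hc'' h0 h1 h2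
  refine ⟨apTrunc_integrable_mul_digammaWeight hFc.aestronglyMeasurable hKb, ?_, ?_⟩
  · -- ARCHIMEDEAN side
    have hGc : ∀ R : ℝ, Continuous fun t : ℝ =>
        weilMellin (fun t : ℝ => f t * ((Literature.Analysis.Calculus.cutoff R t : ℝ) : ℂ))
          (1 / 2 + t * I) := fun R =>
      apTrunc_continuous_weilMellin_half (apTrunc_continuous_trunc hfc R) hb
        (apTrunc_norm_trunc_le h0 R)
    have hAI := apTrunc_tendsto_weilArchIntegral
      (g := fun (R : ℝ) (t : ℝ) => f t * ((Literature.Analysis.Calculus.cutoff R t : ℝ) : ℂ))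
      hKb hGc hτ hτb
    have h3 : Tendsto (fun R : ℝ => (1 / (2 * π) : ℂ) *
        weilArchIntegral (fun t : ℝ => f t * ((Literature.Analysis.Calculus.cutoff R t : ℝ) : ℂ)) -
          f 0 * (Real.log π : ℂ)) atTop (𝓝 (weilArchTerm f)) :=
      (hAI.const_mul _).sub_const _
    refine h3.congr' ?_
    filter_upwards [eventually_ge_atTop (1 : ℝ)] with R hR
    have hχ0 : Literature.Analysis.Calculus.cutoff R 0 = 1 :=
      Literature.Analysis.Calculus.cutoff_eq_one (by rw [abs_zero]; linarith)
    unfold weilArchTerm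
    beta_reduce
    rw [hχ0, Complex.ofReal_one, mul_one]
  · -- POLAR side
    rw [tendsto_iff_norm_sub_tendsto_zero]
    refine squeeze_zero (fun R => norm_nonneg _) (fun R => ?_)
      (show Tendsto (fun R => 2 * τ R) atTop (𝓝 0) by simpa using hτ.const_mul 2)
    have e0 := hτb R 0 (by simp) (by simp)
    have e1 := hτb R 1 (by simp) (by simp)
    simp only [Complex.zero_im, Complex.one_im] at e0 e1
    norm_num at e0 e1
    unfold weilPolarTerm
    calc ‖weilMellin (fun t : ℝ => f t * ((Literature.Analysis.Calculus.cutoff R t : ℝ) : ℂ)) 0 +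
          weilMellin (fun t : ℝ => f t * ((Literature.Analysis.Calculus.cutoff R t : ℝ) : ℂ)) 1 -
          (weilMellin f 0 + weilMellin f 1)‖
        = ‖(weilMellin f 0 -
            weilMellin (fun t : ℝ => f t * ((Literature.Analysis.Calculus.cutoff R t : ℝ) : ℂ)) 0) +
            (weilMellin f 1 -
            weilMellin (fun t : ℝ => f t * ((Literature.Analysis.Calculus.cutoff R t : ℝ) : ℂ)) 1)‖ := by
          rw [← norm_neg]
          congr 1
          ring
      _ ≤ ‖weilMellin f 0 -
            weilMellin (fun t : ℝ => f t * ((Literature.Analysis.Calculus.cutoff R t : ℝ) : ℂ)) 0‖ +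
            ‖weilMellin f 1 -
            weilMellin (fun t : ℝ => f t * ((Literature.Analysis.Calculus.cutoff R t : ℝ) : ℂ)) 1‖ :=
          norm_add_le _ _
      _ ≤ τ R + τ R := add_le_add e0 e1
      _ = 2 * τ R := by ring

end Summit.RiemannHypothesis.RiemannHypothesis.Theorems.GroundStatesConvergeToXi

end
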